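import Summits.KontsevichZagierPeriods.KontsevichZagierPeriods.Theorems.LinRedNormalFormArrangementNormalFormStubRebaseSimplePosOnePosQuadFarFrame
import Summits.KontsevichZagierPeriods.KontsevichZagierPeriods.Theorems.LinRedNormalFormArrangementNormalFormStubRebaseSimplePosOnePosSepPredList

/-!
# Stub `stub_rebaseSimplePosOnePos` (crux `ArrangementNormalForm`, line `janus-bands`) —
part `QuadFarSep`: separating the far silent factors (`B = 2`)

`B = 2` corner calculus. A literal one-fibre datum over the base `(x₁, x₂, y)` with base pole
`y = 0` and letter `0` whose silent factors `Lⱼ(x₁, x₂)` of a chosen class `S` (the FAR factors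
depending on `x₂`) do not vanish on the domain and satisfy the ratio condition
`|x₂ − λ_{j'}(x₁)| ≤ C |λ_j(x₁) − λ_{j'}(x₁)|` pairwise on the domain (`λⱼ` the `x₂`-letter of
`Lⱼ`; both hold after localisation at a flat point in a generic direction) is congruent modulo
`KZ.relations` to a sum of literal data of the SAME kind over the SAME domain in which all
`S`-factors with non-zero exponent are ONE affine form `x₂ − λ(x₁)` (`RebasePos.good_of_farSep`,
with the terminal data handed to a hypothesis `Hterm`): read the datum in the separation frame
(part `QuadFarFrame`, rule 2), run the separation engine with the non-`S` letters protected and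
the invariant "all silent factors are `y`-free except exactly one simple pole `y`"
(`SeparatePos.sep_of_list`, rule 1b; `RebasePos.PLQ_sep`, `PLQ_snoc`), and read every terminal shape back as a
literal datum
(`RebasePos.glit_of_termQ`). Registered as `rebaseSimplePos_farSep`.

References: M. Kontsevich, D. Zagier, *Periods* (2001), §1.2, rules (1b), (2).
-/

noncomputable section

open Set MeasureTheory MvPolynomial
open Literature.NumberTheory.Transcendental Literature.ModelTheory.ExponentialFields

namespace Summit.KontsevichZagierPeriods.ArrangementNormalForm.JanusBands

namespace RebasePos

open SeparatePos

section FarSep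

variable {m : ℕ}

/-- The pole `y` as a silent factor of the separation frame. -/
def poleQ : (Fin 2 → ℚ) × ℚ := (![0, 1], 0)

/-- The line `x₂ − λ(x₁)` of an `x₂`-letter `λ`, as a silent form over `(x₁, x₂)`. -/
def lineOfLamQ (lam : (Fin 2 → ℚ) × ℚ) : (Fin 2 → ℚ) × ℚ := (![-lam.1 0, 1], -lam.2)

/-- A silent factor of the separation frame read back over `(x₁, x₂)` (the pole is dropped). -/
def backLQ (d : (Fin 2 → ℚ) × ℚ) : (Fin 2 → ℚ) × ℚ := (![d.1 0, 0], d.2)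

/-- The silent factors of a terminal shape, read back: the `y`-free factors, then the lines of
the letters. -/
def termLsQ {n : ℕ} (L' : Fin n → (Fin 2 → ℚ) × ℚ) (L : Fin m → (Fin 2 → ℚ) × ℚ) : Fin (n + m) → (Fin 2 → ℚ) × ℚ :=
  Fin.append (fun i => backLQ (L' i)) (fun j => lineOfLamQ (sepLamQ L j))

/-- Their exponents (`0` for the pole entries). -/
def termEsQ {n : ℕ} (L' : Fin n → (Fin 2 → ℚ) × ℚ) (e' : Fin n → ℕ) (d' : Fin m → ℕ) : Fin (n + m) → ℕ :=
  Fin.append (fun i => if (L' i).1 1 = 0 then e' i else 0) d'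

/-- The initial silent factors satisfy the invariant. -/
theorem PLQ_sep (L : Fin m → (Fin 2 → ℚ) × ℚ) (e : Fin m → ℕ) :
    (∀ i, (sepLsQ L i).1 1 = 0 ∨ sepLsQ L i = poleQ) ∧ (∑ i, if sepLsQ L i = poleQ then sepEsQ L e i else 0) = 1 := by
  have hne : ∀ j : Fin m, (sepLsQ L (Fin.castSucc j)) ≠ poleQ := fun j h => by
    have := congrArg (fun q : (Fin 2 → ℚ) × ℚ => q.1 1) h
    simp [sepLsQ, poleQ] at this
  refine ⟨fun i => ?_, ?_⟩
  · refine Fin.lastCases (Or.inr ?_) (fun j => Or.inl ?_) i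
    · simp [sepLsQ, poleQ]
    · simp [sepLsQ]
  · rw [Fin.sum_univ_castSucc]
    simp only [hne, if_false, Finset.sum_const_zero, zero_add]
    simp [sepLsQ, sepEsQ, poleQ]

/-- The invariant is preserved when a resultant of two letters is appended with exponent `1`. -/
theorem PLQ_snoc {n : ℕ} (L' : Fin n → (Fin 2 → ℚ) × ℚ) (e' : Fin n → ℕ) (L : Fin m → (Fin 2 → ℚ) × ℚ)
    (j j' : Fin m) (h : ((∀ i, (L' i).1 1 = 0 ∨ L' i = poleQ) ∧ (∑ i, if L' i = poleQ then e' i else 0) = 1)) :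
    (∀ i, ((Fin.snoc L' (sepLamQ L j - sepLamQ L j') : Fin (n + 1) → (Fin 2 → ℚ) × ℚ) i).1 1 = 0 ∨
        (Fin.snoc L' (sepLamQ L j - sepLamQ L j') : Fin (n + 1) → (Fin 2 → ℚ) × ℚ) i = poleQ) ∧
      (∑ i, if (Fin.snoc L' (sepLamQ L j - sepLamQ L j') : Fin (n + 1) → (Fin 2 → ℚ) × ℚ) i = poleQ then
        (Fin.snoc e' 1 : Fin (n + 1) → ℕ) i else 0) = 1 := by
  obtain ⟨h1, h2⟩ := h
  have hres : (sepLamQ L j - sepLamQ L j').1 1 = 0 := by simp [sepLamQ]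
  have hne : sepLamQ L j - sepLamQ L j' ≠ poleQ := fun h => by
    have := congrArg (fun q : (Fin 2 → ℚ) × ℚ => q.1 1) h
    rw [hres] at this
    simp [poleQ] at this
  refine ⟨fun i => ?_, ?_⟩
  · refine Fin.lastCases ?_ (fun i => ?_) i
    · rw [Fin.snoc_last]; exact Or.inl hres
    · rw [Fin.snoc_castSucc]; exact h1 i
  · rw [Fin.sum_univ_castSucc]
    simp only [Fin.snoc_castSucc, Fin.snoc_last, hne, if_false, add_zero]
    exact h2

/-- The `y`-power of a terminal shape is `y`. -/
theorem prod_pole_pow {n : ℕ} (L' : Fin n → (Fin 2 → ℚ) × ℚ) (e' : Fin n → ℕ)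
    (h : ((∀ i, (L' i).1 1 = 0 ∨ L' i = poleQ) ∧ (∑ i, if L' i = poleQ then e' i else 0) = 1)) (y : ℝ) :
    ∏ i, (if L' i = poleQ then y ^ e' i else 1) = y := by
  have key : ∀ i, (if L' i = poleQ then y ^ e' i else 1) = y ^ (if L' i = poleQ then e' i else 0) := fun i => by
    split_ifs <;> simp
  simp only [key, Finset.prod_pow_eq_pow_sum, h.2, pow_one]

/-- A silent factor of a terminal shape, read back in the original frame. -/
theorem pow_affB_back {n : ℕ} (L' : Fin n → (Fin 2 → ℚ) × ℚ) (e' : Fin n → ℕ)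
    (h : ((∀ i, (L' i).1 1 = 0 ∨ L' i = poleQ) ∧ (∑ i, if L' i = poleQ then e' i else 0) = 1)) (i : Fin n)
    (w : Fin (2 + 1 + 1) → ℝ) :
    affB 2 1 (L' i) (fun l => w (eQ l)) ^ e' i =
      affB 2 1 (backLQ (L' i)) w ^ (if (L' i).1 1 = 0 then e' i else 0) * (if L' i = poleQ then w 2 ^ e' i else 1) := by
  rcases h.1 i with h0 | hp
  · have hne : L' i ≠ poleQ := fun hp => by rw [hp, poleQ] at h0; simp at h0
    rw [if_pos h0, if_neg hne, mul_one, affB_three, affB_three, backLQ]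
    simp [h0]
  · have h1 : (L' i).1 1 ≠ 0 := by rw [hp, poleQ]; simp
    rw [if_neg h1, if_pos hp, pow_zero, one_mul, hp, poleQ, affB_three]
    simp

/-- The line of a letter evaluates to `x₂ − λ(x₁)`. -/
theorem affB_lineOfLamQ (L : Fin m → (Fin 2 → ℚ) × ℚ) (j : Fin m) (w : Fin (2 + 1 + 1) → ℝ) :
    affB 2 1 (lineOfLamQ (sepLamQ L j)) w = w 1 - affB 2 1 (sepLamQ L j) (fun l => w (eQ l)) := by
  rw [affB_three, affB_three, lineOfLamQ, sepLamQ]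
  simp
  ring

/-- The letters are `x₁`-forms: they read the same in both frames. -/
theorem affB_sepLamQ_eQ (L : Fin m → (Fin 2 → ℚ) × ℚ) (j : Fin m) (w : Fin (2 + 1 + 1) → ℝ) :
    affB 2 1 (sepLamQ L j) (fun l => w (eQ l)) = affB 2 1 (sepLamQ L j) w := by
  rw [affB_three, affB_three, sepLamQ]
  simp

/-- **A terminal shape of the separation frame, read back as a literal datum.** -/
theorem glit_of_termQ {n : ℕ} (L' : Fin n → (Fin 2 → ℚ) × ℚ) (e' : Fin n → ℕ)
    (h : ((∀ i, (L' i).1 1 = 0 ∨ L' i = poleQ) ∧ (∑ i, if L' i = poleQ then e' i else 0) = 1))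
    (L : Fin m → (Fin 2 → ℚ) × ℚ) (e : Fin m → ℕ) (p : MvPolynomial (Fin 2) ℚ) (d' : Fin m → ℕ) (ℓ₁ : (Fin 2 → ℚ) × ℚ)
    (w : Fin (2 + 1 + 1) → ℝ) :
    shape 2 1 (sepPQ L e p) L' e' (sepLamQ L) d' (fun _ => some 0) (fun l => w (eQ l)) =
      glit 2 1 (MvPolynomial.C (sepCQ L e) * p) (termLsQ L' L) (termEsQ L' e' d') ℓ₁ 0 0 1 (fun _ => some 0) w := by
  have hfib : fib 2 1 (fun _ : Fin 1 => some (0 : (Fin (2 + 1) → ℚ) × ℚ)) (fun l => w (eQ l)) = 1 / w 3 := by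
    simp [fib]
  have hnum : MvPolynomial.aeval (fun i : Fin (2 + 1) => (fun l => w (eQ l)) (Fin.castAdd 1 i)) (sepPQ L e p) =
      ((sepCQ L e : ℚ) : ℝ) * MvPolynomial.aeval (fun i : Fin 2 => w (Fin.castSucc (Fin.castSucc i))) p := by
    have h1 := aeval_sepPQ L e p (fun l => w (eQ l))
    rw [eQ_eQ] at h1
    exact h1
  have hprodL : ∏ i, affB 2 1 (L' i) (fun l => w (eQ l)) ^ e' i =
      (∏ i, affB 2 1 (backLQ (L' i)) w ^ (if (L' i).1 1 = 0 then e' i else 0)) * w 2 := by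
    simp only [pow_affB_back L' e' h, Finset.prod_mul_distrib, prod_pole_pow L' e' h]
  have hprod : ∏ i, affB 2 1 (termLsQ L' L i) w ^ termEsQ L' e' d' i =
      (∏ i, affB 2 1 (backLQ (L' i)) w ^ (if (L' i).1 1 = 0 then e' i else 0)) *
        ∏ j, (w 1 - affB 2 1 (sepLamQ L j) (fun l => w (eQ l))) ^ d' j := by
    rw [termLsQ, termEsQ, Fin.prod_univ_add]
    simp only [Fin.append_left, Fin.append_right, affB_lineOfLamQ]
  have h0 : affB 2 1 (0 : (Fin 2 → ℚ) × ℚ) w = 0 := by simp [affB_three]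
  rw [glit_three, shape, hfib, hnum, hprodL, hprod, map_mul, MvPolynomial.aeval_C, eq_ratCast, h0, sub_zero,
    show (Fin.castAdd 1 (Fin.last 2) : Fin (2 + 1 + 1)) = 2 from rfl, eQ_two]
  simp only [Finset.prod_inv_distrib, mul_inv, div_eq_mul_inv]
  ring

variable (L : Fin m → (Fin 2 → ℚ) × ℚ) (e : Fin m → ℕ) (ℓ₁ : (Fin 2 → ℚ) × ℚ) {m' : ℕ}

/-- **Separating the far silent factors** (`B = 2`). See the module docstring. `S`: the
factors to separate (depending on `x₂`, `hS`), non-vanishing on the domain (`hpole`) and with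
the pairwise ratio condition (`hwall`, in the original coordinates `x₁ = z 0`, `x₂ = z 1`);
`Hterm`: every literal datum of the same kind over the same domain whose `S`-like far structure
is reduced — numerator `c · p`, silent factors `y`-free forms read from the engine and the
lines `x₂ − λⱼ(x₁)` of the letters, with all lines of ACTIVE `S`-letters equal — is good. -/
theorem good_of_farSep (s : KZ.IntegralRep (2 + 1 + 1)) (M : Fin m' → (Fin (2 + 1) → ℚ) × ℚ)
    (p : MvPolynomial (Fin 2) ℚ) (u v : (Fin (2 + 1) → ℚ) × ℚ) (hbd : Bornology.IsBounded s.domain)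
    (hdom : s.domain = gDom 2 1 m' M (fun _ => Sum.inr u) (fun _ => Sum.inr v))
    (hint : EqOn s.integrand (glit 2 1 p L e ℓ₁ 0 0 1 (fun _ => some 0)) s.domain)
    (S : Fin m → Prop) [DecidablePred S] (hS : ∀ j, S j → (L j).1 1 ≠ 0)
    (hpole : ∀ j, S j → e j ≠ 0 → ∀ z ∈ s.domain, affB 2 1 (L j) z ≠ 0)
    (hwall : ∀ j j', S j → S j' → e j ≠ 0 → e j' ≠ 0 → sepLamQ L j ≠ sepLamQ L j' → ∃ C : ℝ, ∀ z ∈ s.domain,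
      |z 1 - affB 2 1 (sepLamQ L j') z| ≤ C * |affB 2 1 (sepLamQ L j) z - affB 2 1 (sepLamQ L j') z|)
    (Hterm : ∀ (n : ℕ) (L' : Fin n → (Fin 2 → ℚ) × ℚ) (e' : Fin n → ℕ) (d' : Fin m → ℕ) (s' : KZ.IntegralRep (2 + 1 + 1)),
      Bornology.IsBounded s'.domain → s'.domain = gDom 2 1 m' M (fun _ => Sum.inr u) (fun _ => Sum.inr v) →
      EqOn s'.integrand (glit 2 1 (MvPolynomial.C (sepCQ L e) * p) (termLsQ L' L) (termEsQ L' e' d') ℓ₁ 0 0 1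
        (fun _ => some 0)) s'.domain →
      (∀ i, (L' i).1 1 = 0 ∨ L' i = poleQ) →
      (∀ j j', S j → S j' → d' j ≠ 0 → d' j' ≠ 0 → sepLamQ L j = sepLamQ L j') →
      ∃ c ∈ AddSubgroup.closure (GGset 2 2 1), KZ.of s' - c ∈ KZ.relations) :
    ∃ c ∈ AddSubgroup.closure (GGset 2 2 1), KZ.of s - c ∈ KZ.relations := by
  classical
  -- the separation frame
  set sE := s.reindex eQ with hsE
  have hrelE : KZ.of s - KZ.of sE ∈ KZ.relations := IntegrateOut.of_sub_of_reindex_mem_relations s eQ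
  have hdomE : sE.domain = gDom 2 1 m' (fun j => swapFQ (M j)) (fun _ => Sum.inr (swapFQ u)) (fun _ => Sum.inr (swapFQ v)) := by
    ext w
    rw [hsE, KZ.IntegralRep.reindex_domain, mem_setOf_eq, mem_gDom_swapFQ, hdom]
  have hmemE : ∀ w, w ∈ sE.domain ↔ (fun l => w (eQ l)) ∈ s.domain := fun w => by
    rw [hsE, KZ.IntegralRep.reindex_domain, mem_setOf_eq]
  have hintE : EqOn sE.integrand (shape 2 1 (sepPQ L e p) (sepLsQ L) (sepEsQ L e) (sepLamQ L) (sepDQ L e)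
      (fun _ => some 0)) sE.domain := fun w hw => by
    show s.integrand (fun l => w (eQ l)) = _
    rw [hint ((hmemE w).1 hw), shape_sepQ L e p ℓ₁]
  have hbdE : Bornology.IsBounded sE.domain := by
    obtain ⟨C, hC⟩ := isBounded_iff_forall_norm_le.mp hbd
    refine isBounded_iff_forall_norm_le.mpr ⟨C, fun w hw => le_trans ?_ (hC _ ((hmemE w).1 hw))⟩
    refine (pi_norm_le_iff_of_nonneg (norm_nonneg _)).mpr fun j => ?_
    have h := norm_le_pi_norm (fun l => w (eQ l)) (eQ.symm j)
    simpa using h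
  -- the engine, with the terminal class of good representations
  set T : Set KZ.FormalRep := {x | ∃ c ∈ AddSubgroup.closure (GGset 2 2 1), x - c ∈ KZ.relations} with hT
  have hTsub : ∀ c ∈ AddSubgroup.closure T, ∃ c' ∈ AddSubgroup.closure (GGset 2 2 1), c - c' ∈ KZ.relations := by
    intro c hc
    refine AddSubgroup.closure_induction (fun x hx => hx) ⟨0, zero_mem _, by simp⟩ ?_ ?_ hc
    · rintro x y - - ⟨cx, hcx, hx⟩ ⟨cy, hcy, hy⟩
      refine ⟨cx + cy, add_mem hcx hcy, ?_⟩
      have : x + y - (cx + cy) = (x - cx) + (y - cy) := by abel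
      rw [this]; exact add_mem hx hy
    · rintro x - ⟨cx, hcx, hx⟩
      refine ⟨-cx, neg_mem hcx, ?_⟩
      have : -x - -cx = -(x - cx) := by abel
      rw [this]; exact neg_mem hx
  suffices hmain : ∃ c ∈ AddSubgroup.closure T, KZ.of sE - c ∈ KZ.relations by
    obtain ⟨c, hc, hc'⟩ := hmain
    obtain ⟨c', hc'', hcc⟩ := hTsub c hc
    refine ⟨c', hc'', ?_⟩
    have : KZ.of s - c' = (KZ.of s - KZ.of sE) + (KZ.of sE - c) + (c - c') := by abel
    rw [this]
    exact add_mem (add_mem hrelE hc') hcc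
  refine sep_of_list (fun j => swapFQ (M j)) (sepPQ L e p) (sepLamQ L) (fun _ => some 0) (fun _ => Sum.inr (swapFQ u))
    (fun _ => Sum.inr (swapFQ v)) S
    (fun L' e' => (∀ i, (L' i).1 1 = 0 ∨ L' i = poleQ) ∧ (∑ i, if L' i = poleQ then e' i else 0) = 1) T
    (fun L' e' j j' _ _ hL' => PLQ_snoc L' e' L j j' hL') ?_
    (sepLsQ L) (sepEsQ L e) (sepDQ L e) sE (PLQ_sep L e) hbdE hdomE hintE ?_ ?_
  · -- the terminal class: read back and apply `Hterm`
    intro n L' e' d' s' hPL hbd' hdom' hint' hpole' hall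
    set s'' := s'.reindex eQ with hs''
    have hrel'' : KZ.of s' - KZ.of s'' ∈ KZ.relations := IntegrateOut.of_sub_of_reindex_mem_relations s' eQ
    have hmem'' : ∀ w, w ∈ s''.domain ↔ (fun l => w (eQ l)) ∈ s'.domain := fun w => by
      rw [hs'', KZ.IntegralRep.reindex_domain, mem_setOf_eq]
    have hdom'' : s''.domain = gDom 2 1 m' M (fun _ => Sum.inr u) (fun _ => Sum.inr v) := by
      ext w
      rw [hmem'', hdom', mem_gDom_swapFQ, eQ_eQ]
    have hint'' : EqOn s''.integrand (glit 2 1 (MvPolynomial.C (sepCQ L e) * p) (termLsQ L' L) (termEsQ L' e' d') ℓ₁ 0 0 1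
        (fun _ => some 0)) s''.domain := fun w hw => by
      show s'.integrand (fun l => w (eQ l)) = _
      rw [hint' ((hmem'' w).1 hw), glit_of_termQ L' e' hPL]
    have hbd'' : Bornology.IsBounded s''.domain := by rw [hdom'', ← hdom]; exact hbd
    obtain ⟨c, hc, hc'⟩ := Hterm n L' e' d' s'' hbd'' hdom'' hint'' hPL.1 hall
    refine ⟨c, hc, ?_⟩
    have : KZ.of s' - c = (KZ.of s' - KZ.of s'') + (KZ.of s'' - c) := by abel
    rw [this]
    exact add_mem hrel'' hc'
  · -- the letters of `S` do not vanish on the domain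
    intro j hj hdj w hw
    have hw' := (hmemE w).1 hw
    have hd : e j ≠ 0 := by rwa [sepDQ, if_neg (hS j hj)] at hdj
    have h := hpole j hj hd _ hw'
    rw [affB_eQ_letter _ (hS j hj)] at h
    rw [show (Fin.castAdd 1 (Fin.last 2) : Fin (2 + 1 + 1)) = 2 from rfl]
    intro h0
    refine h ?_
    rw [sepLamQ] at h0
    rw [h0, mul_zero]
  · -- the ratio condition
    intro j j' hj hj' hdj hdj' hne
    have hd : e j ≠ 0 := by rwa [sepDQ, if_neg (hS j hj)] at hdj
    have hd' : e j' ≠ 0 := by rwa [sepDQ, if_neg (hS j' hj')] at hdj'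
    obtain ⟨C, hC⟩ := hwall j j' hj hj' hd hd' hne
    refine ⟨C, fun w hw => ?_⟩
    have h := hC _ ((hmemE w).1 hw)
    rw [show (Fin.castAdd 1 (Fin.last 2) : Fin (2 + 1 + 1)) = 2 from rfl]
    simp only [affB_sepLamQ_eQ, eQ_one] at h
    exact h

end FarSep

end RebasePos

/-- **Registered part of `stub_rebaseSimplePosOnePos` (line `janus-bands`, `B = 2` corner
calculus): separating the far silent factors** (`RebasePos.good_of_farSep`). A literal
one-fibre datum over the base `(x₁, x₂, y)` (base pole `y = 0`, letter `0`) whose silent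
factors of a class `S` depend on `x₂`, do not vanish on the domain and satisfy the pairwise
ratio condition `|x₂ − λ_{j'}(x₁)| ≤ C |λ_j(x₁) − λ_{j'}(x₁)|` there is congruent modulo
`KZ.relations` to the subgroup generated by `GG 2 2 1` as soon as (`Hterm`) so is every literal
datum of the same kind over the same domain whose `x₂`-dependent silent factors are the lines
`x₂ − λⱼ(x₁)` of the letters with all ACTIVE `S`-lines equal (rules 2, 1b: separation frame,
protected separation engine, read-back). -/
theorem rebaseSimplePos_farSep (m m' : ℕ) (L : Fin m → (Fin 2 → ℚ) × ℚ) (e : Fin m → ℕ) (ℓ₁ : (Fin 2 → ℚ) × ℚ) (s : KZ.IntegralRep (2 + 1 + 1)) (M : Fin m' → (Fin (2 + 1) → ℚ) × ℚ) (p : MvPolynomial (Fin 2) ℚ) (u v : (Fin (2 + 1) → ℚ) × ℚ) (hbd : Bornology.IsBounded s.domain) (hdom : s.domain = SeparatePos.gDom 2 1 m' M (fun _ => Sum.inr u) (fun _ => Sum.inr v)) (hint : Set.EqOn s.integrand (RebasePos.glit 2 1 p L e ℓ₁ 0 0 1 (fun _ => some 0)) s.domain) (S : Fin m → Prop) [DecidablePred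 S] (hS : ∀ j, S j → (L j).1 1 ≠ 0) (hpole : ∀ j, S j → e j ≠ 0 → ∀ z ∈ s.domain, SeparatePos.affB 2 1 (L j) z ≠ 0) (hwall : ∀ j j', S j → S j' → e j ≠ 0 → e j' ≠ 0 → RebasePos.sepLamQ L j ≠ RebasePos.sepLamQ L j' → ∃ C : ℝ, ∀ z ∈ s.domain, |z 1 - SeparatePos.affB 2 1 (RebasePos.sepLamQ L j') z| ≤ C * |SeparatePos.affB 2 1 (RebasePos.sepLamQ L j) z - SeparatePos.affB 2 1 (RebasePos.sepLamQ L j') z|) (Hterm : ∀ (n : ℕ) (L' : Fin n → (Fin 2 → ℚ) × ℚ) (e' : Fin n → ℕ) (d' : Fin m → ℕ) (s' : KZ.IntegralRep (2 + 1 + 1)), Bornology.IsBounded s'.domain → s'.domain = SeparatePos.gDom 2 1 m' M (fun _ => Sum.inr u) (fun _ => Sum.inr v) → Set.EqOn s'.integrand (RebasePos.glit 2 1 (MvPolynomial.C (RebasePos.sepCQ L e) * p) (RebasePos.termLsQ L' L) (RebasePos.termEsQ L' e' d') ℓ₁ 0 0 1 (fun _ => some 0)) s'.domain → (∀ i, (L'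 i).1 1 = 0 ∨ L' i = RebasePos.poleQ) → (∀ j j', S j → S j' → d' j ≠ 0 → d' j' ≠ 0 → RebasePos.sepLamQ L j = RebasePos.sepLamQ L j') → ∃ c ∈ AddSubgroup.closure (SeparatePos.GGset 2 2 1), KZ.of s' - c ∈ KZ.relations) : ∃ c ∈ AddSubgroup.closure (SeparatePos.GGset 2 2 1), KZ.of s - c ∈ KZ.relations :=
  RebasePos.good_of_farSep L e ℓ₁ s M p u v hbd hdom hint S hS hpole hwall Hterm

end Summit.KontsevichZagierPeriods.ArrangementNormalForm.JanusBands
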